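import Summits.CriticalPhenomena.PercolationContinuityZ3.Theorems.PercNearOneGluingNoHeavyLowerTailKernelTwoPlusLaw
import Summits.CriticalPhenomena.PercolationContinuityZ3.Theorems.PercNearOneGluingNoHeavyLowerTailPairGainExchangeGlued
import Summits.CriticalPhenomena.PercolationContinuityZ3.Theorems.PercNearOneGluingNoHeavyLowerTailPairGainMonotone
import Summits.CriticalPhenomena.PercolationContinuityZ3.Theorems.PercNearOneGluingAdditiveGluingGluingLemma5
import HarnessLib

/-!
# `NoHeavyLowerTail` (stmt-CriticalPhenomena-4575) — the FORMAL FACE of the `2 + (any law)` kernel, regime B, ONE ATOM: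
# the graph-level inequality behind `f_Y ≥ u·r_{p*,Y} + (1−u)·r_{q*,Y}` (memo LF3-BETA-R §13, nonempty atom)

Support file (lemma factory `prim-lf-3` gen 7, seat g9; `--supports stmt-CriticalPhenomena-4575`).  No definitions, no named
facts, no sorries.

Setting: weights `w` (the core), a block `Y ∌ b` glued (`L := glue_Y w`), a pair `{c, d}` disjoint from `Y` with `c` the WEAKER endpoint
in `w` (`μ_w(c ↔ b) ≤ μ_w(d ↔ b)`), `M := L[s(c,d) ↦ 1]`, `N := M[s(c,s₀) ↦ 1]` (`s₀ ∈ Y`; so `N` = everything glued), a vertex `q` that is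
at most as connected as some `y ∈ Y` in the MIXTURE `(1−u)·w + u·w[s(c,d) ↦ 1]`, and a witness `j` with `μ_{w[cd↦1]}(c ↔ b) ≤ μ_{w[cd↦1]}(j ↔ b)`
(regime B: the glued pair does not beat `j`).  Then (`faceB_atom`)

  `(1−u)[μ_L(s₀b) − μ_L(jb)] + u[μ_N(cb) − μ_N(jb)]
      ≥ u[(1−u)(μ_L(cb) − μ_L(jb)) + u(μ_M(cb) − μ_M(jb))] + (1−u)[(1−u)(μ_L(qb) − μ_L(jb)) + u(μ_M(qb) − μ_M(jb))]`.

With `Y` an atom of the second unit, `{c,d}` the two-port star and `q = q*` its `K_u`-weakest port, the left side is the face value `f_Y`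
and the right side is `u·r_{c,Y} + (1−u)·r_{q,Y}` (memo §11–13).  Proof (memo §13 (b)): the anchored exchange `anchoredExchange` (ranking
`[cd] ≤ j` before `Y` is glued), Kozma–Nitzan's Lemma 5 `stub_gluingLemma5` in the mixture graph (realised by raising the pair, `real_raisePair_eq_mix`),
and the anchored pair-gain exchange `pairGain_exchange_glued` (ranking `c ≤ d` before `Y` is glued), plus inclusion–exclusion bookkeeping
(`real_openConn_pair_eq`, `real_openConn_pair_third`).
-/

namespace Summit.CriticalPhenomena.PercolationContinuityZ3.Theorems

open MeasureTheory Set ProbabilityTheory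
open Literature.Probability.LatticeModels
open Literature.Probability.Percolation

noncomputable section
open Classical

namespace UpsetExchange

variable {n : ℕ}

/-- Gluing a block `Y` commutes with modifying a pair not inside `Y`. [folklore] -/
theorem glue_modifyPair_comm (w : Sym2 (Fin n) → unitInterval) (Y : Finset (Fin n)) {c d : Fin n} (hcY : c ∉ Y)
    (φ : unitInterval → unitInterval) :
    (fun e : Sym2 (Fin n) => if (∀ x ∈ e, x ∈ Y) ∧ ¬ e.IsDiag then 1 else
        (if e = s(c, d) then φ (w s(c, d)) else w e)) =
      fun f => if f = s(c, d) then
          φ ((fun e : Sym2 (Fin n) => if (∀ x ∈ e, x ∈ Y) ∧ ¬ e.IsDiag then (1 : unitInterval) else w e) s(c, d))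
        else (if (∀ x ∈ f, x ∈ Y) ∧ ¬ f.IsDiag then 1 else w f) := by
  have hcd : ¬ ((∀ x ∈ s(c, d), x ∈ Y) ∧ ¬ (s(c, d)).IsDiag) := fun h => hcY (h.1 c (Sym2.mem_mk_left c d))
  funext f
  by_cases hf : f = s(c, d)
  · subst hf
    simp only [if_neg hcd, if_true]
  · simp only [if_neg hf]

set_option maxHeartbeats 400000 in
/-- **Regime B of the formal face, one nonempty atom** (graph form).  See the module docstring.
[cite: KozmaNitzan2024, Question 9 (p. 36), Lemma 3(i) (p. 6), Lemma 5 (p. 13); VandenbergHaggstromKahn2005, Thm. 1.3] -/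
theorem faceB_atom (w : Sym2 (Fin n) → unitInterval) (Y : Finset (Fin n)) (c d q j b s₀ y : Fin n) (u : unitInterval)
    (hs₀ : s₀ ∈ Y) (hy : y ∈ Y) (hcY : c ∉ Y) (hdY : d ∉ Y) (hbY : b ∉ Y) (hcd : c ≠ d)
    (hle : (prodBernoulli w).real (openConn c b) ≤ (prodBernoulli w).real (openConn d b))
    (hB1 : (prodBernoulli (fun f : Sym2 (Fin n) => if f = s(c, d) then 1 else w f)).real (openConn c b) ≤
      (prodBernoulli (fun f : Sym2 (Fin n) => if f = s(c, d) then 1 else w f)).real (openConn j b))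
    (hqy : (1 - (u : ℝ)) * (prodBernoulli w).real (openConn q b) +
        (u : ℝ) * (prodBernoulli (fun f : Sym2 (Fin n) => if f = s(c, d) then 1 else w f)).real (openConn q b) ≤
      (1 - (u : ℝ)) * (prodBernoulli w).real (openConn y b) +
        (u : ℝ) * (prodBernoulli (fun f : Sym2 (Fin n) => if f = s(c, d) then 1 else w f)).real (openConn y b)) :
    (u : ℝ) * ((1 - (u : ℝ)) *
          ((prodBernoulli (fun e : Sym2 (Fin n) => if (∀ x ∈ e, x ∈ Y) ∧ ¬ e.IsDiag then 1 else w e)).real (openConn c b) -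
            (prodBernoulli (fun e : Sym2 (Fin n) => if (∀ x ∈ e, x ∈ Y) ∧ ¬ e.IsDiag then 1 else w e)).real (openConn j b)) +
        (u : ℝ) *
          ((prodBernoulli (fun f : Sym2 (Fin n) => if f = s(c, d) then 1 else
              (if (∀ x ∈ f, x ∈ Y) ∧ ¬ f.IsDiag then 1 else w f))).real (openConn c b) -
            (prodBernoulli (fun f : Sym2 (Fin n) => if f = s(c, d) then 1 else
              (if (∀ x ∈ f, x ∈ Y) ∧ ¬ f.IsDiag then 1 else w f))).real (openConn j b))) +
      (1 - (u : ℝ)) * ((1 - (u : ℝ)) *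
          ((prodBernoulli (fun e : Sym2 (Fin n) => if (∀ x ∈ e, x ∈ Y) ∧ ¬ e.IsDiag then 1 else w e)).real (openConn q b) -
            (prodBernoulli (fun e : Sym2 (Fin n) => if (∀ x ∈ e, x ∈ Y) ∧ ¬ e.IsDiag then 1 else w e)).real (openConn j b)) +
        (u : ℝ) *
          ((prodBernoulli (fun f : Sym2 (Fin n) => if f = s(c, d) then 1 else
              (if (∀ x ∈ f, x ∈ Y) ∧ ¬ f.IsDiag then 1 else w f))).real (openConn q b) -
            (prodBernoulli (fun f : Sym2 (Fin n) => if f = s(c, d) then 1 else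
              (if (∀ x ∈ f, x ∈ Y) ∧ ¬ f.IsDiag then 1 else w f))).real (openConn j b))) ≤
    (1 - (u : ℝ)) *
        ((prodBernoulli (fun e : Sym2 (Fin n) => if (∀ x ∈ e, x ∈ Y) ∧ ¬ e.IsDiag then 1 else w e)).real (openConn s₀ b) -
          (prodBernoulli (fun e : Sym2 (Fin n) => if (∀ x ∈ e, x ∈ Y) ∧ ¬ e.IsDiag then 1 else w e)).real (openConn j b)) +
      (u : ℝ) *
        ((prodBernoulli (fun f : Sym2 (Fin n) => if f = s(c, s₀) then 1 else (if f = s(c, d) then 1 else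
            (if (∀ x ∈ f, x ∈ Y) ∧ ¬ f.IsDiag then 1 else w f)))).real (openConn c b) -
          (prodBernoulli (fun f : Sym2 (Fin n) => if f = s(c, s₀) then 1 else (if f = s(c, d) then 1 else
            (if (∀ x ∈ f, x ∈ Y) ∧ ¬ f.IsDiag then 1 else w f)))).real (openConn j b)) := by
  -- the three graphs
  set L : Sym2 (Fin n) → unitInterval := fun e => if (∀ x ∈ e, x ∈ Y) ∧ ¬ e.IsDiag then 1 else w e with hL
  set M : Sym2 (Fin n) → unitInterval := fun f => if f = s(c, d) then 1 else L f with hM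
  set N : Sym2 (Fin n) → unitInterval := fun f => if f = s(c, s₀) then 1 else M f with hN
  set wP : Sym2 (Fin n) → unitInterval := fun f => if f = s(c, d) then 1 else w f with hwP
  have hcs₀ : c ≠ s₀ := fun h => hcY (h ▸ hs₀)
  have hmeas : ∀ X : Set (BondConfig (Fin n)), MeasurableSet X := fun _ => MeasurableSet.of_discrete
  have hu0 : 0 ≤ (u : ℝ) := unitInterval.nonneg u
  have hu1 : 0 ≤ 1 - (u : ℝ) := sub_nonneg.2 (unitInterval.le_one u)
  -- (E) the anchored exchange, ranking `c ≤ j` in `w[cd ↦ 1]`, block `Y` glued afterwards; `glue_Y (w[cd↦1]) = M`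
  have hswap : (fun e : Sym2 (Fin n) => if (∀ x ∈ e, x ∈ Y) ∧ ¬ e.IsDiag then 1 else wP e) = M := by
    have h := glue_modifyPair_comm w Y (c := c) (d := d) hcY (fun _ => 1)
    simpa only [hwP, hM, hL] using h
  have hT3 : (prodBernoulli M).real (openConn c b ∩ (openConn s₀ b)ᶜ ∩ openConn j s₀) ≤
      (prodBernoulli M).real (openConn s₀ b ∩ (openConn c b)ᶜ ∩ (openConn j c)ᶜ) := by
    have h := anchoredExchange wP Y c j b s₀ hs₀ hB1
    rw [hswap] at h
    exact h
  -- (W) the anchored pair-gain exchange, ranking `c ≤ d` in `w`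
  have hT2 : (prodBernoulli L).real (openConn c b ∩ (openConn d b)ᶜ ∩ openConn d s₀) ≤
      (prodBernoulli L).real (openConn d b ∩ (openConn c b)ᶜ ∩ (openConn c s₀)ᶜ) :=
    pairGain_exchange_glued w Y c d b s₀ hs₀ hle
  -- (L5) Lemma 5 in the mixture graph `R₀ := w` with the pair raised by `u`; `glue_Y R₀ = ` `L` with the pair raised
  set R₀ : Sym2 (Fin n) → unitInterval := fun f => if f = s(c, d) then Set.Icc.convexComb (w s(c, d)) 1 u else w f with hR₀
  set R : Sym2 (Fin n) → unitInterval := fun f => if f = s(c, d) then Set.Icc.convexComb (L s(c, d)) 1 u else L f with hR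
  have hswapR : (fun e : Sym2 (Fin n) => if (∀ x ∈ e, x ∈ Y) ∧ ¬ e.IsDiag then 1 else R₀ e) = R := by
    have h := glue_modifyPair_comm w Y (c := c) (d := d) hcY (fun t => Set.Icc.convexComb t 1 u)
    simpa only [hR₀, hR, hL] using h
  have hmixw : ∀ X : Set (BondConfig (Fin n)), (prodBernoulli R₀).real X =
      (1 - (u : ℝ)) * (prodBernoulli w).real X + (u : ℝ) * (prodBernoulli wP).real X :=
    fun X => real_raisePair_eq_mix w s(c, d) u X
  have hmixL : ∀ X : Set (BondConfig (Fin n)), (prodBernoulli R).real X =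
      (1 - (u : ℝ)) * (prodBernoulli L).real X + (u : ℝ) * (prodBernoulli M).real X :=
    fun X => real_raisePair_eq_mix L s(c, d) u X
  have hqyR : (prodBernoulli R₀).real (openConn q b) ≤ (prodBernoulli R₀).real (openConn y b) := by
    rw [hmixw, hmixw]; exact hqy
  have hL5 := stub_gluingLemma5 n R₀ Y q y b hy hbY hqyR
  rw [hswapR] at hL5
  -- in `R` the block `Y` is a.s. connected, so `⋃_{s ∈ Y} {s ↔ b}` has the measure of `{s₀ ↔ b}`
  have hUle : (prodBernoulli R).real (⋃ s ∈ Y, openConn s b) ≤ (prodBernoulli R).real (openConn s₀ b) := by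
    have hsub : (⋃ s ∈ Y, openConn s b : Set (BondConfig (Fin n))) ⊆
        openConn s₀ b ∪ ⋃ s ∈ Y, (openConn s₀ s)ᶜ := by
      intro ω hω
      rcases mem_iUnion₂.1 hω with ⟨s, hs, hsb⟩
      by_cases h0 : ω ∈ openConn s₀ s
      · exact Or.inl ((h0 : (openGraph ω).Reachable s₀ s).trans (hsb : (openGraph ω).Reachable s b))
      · exact Or.inr (mem_iUnion₂.2 ⟨s, hs, h0⟩)
    have hnull : ∀ s ∈ Y, (prodBernoulli R).real (openConn s₀ s)ᶜ = 0 := by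
      intro s hs
      by_cases hss : s₀ = s
      · subst hss
        have : ((openConn s₀ s₀)ᶜ : Set (BondConfig (Fin n))) = ∅ := by
          ext ω; simp only [mem_compl_iff, mem_empty_iff_false, iff_false, not_not]
          exact (SimpleGraph.Reachable.refl s₀ : (openGraph ω).Reachable s₀ s₀)
        rw [this, measureReal_empty]
      · apply real_not_openConn_eq_zero_of_surePair R s₀ s hss
        have hne : s(s₀, s) ≠ s(c, d) := by
          intro h
          have : s₀ ∈ s(c, d) := h ▸ Sym2.mem_mk_left s₀ s
          rcases Sym2.mem_iff.1 this with h1 | h1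
          · exact hcY (h1 ▸ hs₀)
          · exact hdY (h1 ▸ hs₀)
        have hin : (∀ x ∈ s(s₀, s), x ∈ Y) ∧ ¬ (s(s₀, s)).IsDiag :=
          ⟨fun x hx => by rcases Sym2.mem_iff.1 hx with rfl | rfl <;> assumption, by rw [Sym2.mk_isDiag_iff]; exact hss⟩
        simp only [hR, hL, if_neg hne, if_pos hin]
    calc (prodBernoulli R).real (⋃ s ∈ Y, openConn s b)
        ≤ (prodBernoulli R).real (openConn s₀ b ∪ ⋃ s ∈ Y, (openConn s₀ s)ᶜ) := measureReal_mono hsub (measure_ne_top _ _)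
      _ ≤ (prodBernoulli R).real (openConn s₀ b) + (prodBernoulli R).real (⋃ s ∈ Y, (openConn s₀ s)ᶜ) :=
          measureReal_union_le _ _
      _ ≤ (prodBernoulli R).real (openConn s₀ b) + ∑ s ∈ Y, (prodBernoulli R).real (openConn s₀ s)ᶜ := by
          gcongr; exact measureReal_biUnion_finset_le Y _
      _ = (prodBernoulli R).real (openConn s₀ b) := by rw [Finset.sum_eq_zero hnull, add_zero]
  have hT1 : (1 - (u : ℝ)) * (prodBernoulli L).real (openConn q b) + (u : ℝ) * (prodBernoulli M).real (openConn q b) ≤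
      (1 - (u : ℝ)) * (prodBernoulli L).real (openConn s₀ b) + (u : ℝ) * (prodBernoulli M).real (openConn s₀ b) := by
    rw [← hmixL, ← hmixL]; exact hL5.trans hUle
  -- inclusion–exclusion: `N` from `M`
  have hI1 : (prodBernoulli N).real (openConn c b) =
      (prodBernoulli M).real (openConn c b) + (prodBernoulli M).real (openConn s₀ b ∩ (openConn c b)ᶜ) := by
    rw [(real_openConn_pair_eq M hcs₀ b).1]
    have hset : openConn c b ∪ openConn s₀ b = openConn c b ∪ (openConn s₀ b ∩ (openConn c b)ᶜ : Set (BondConfig (Fin n))) := by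
      ext ω; simp only [mem_union, mem_inter_iff, mem_compl_iff]; tauto
    rw [hset, measureReal_union _ ((hmeas _).inter (hmeas _))]
    exact Set.disjoint_left.2 fun ω h1 h2 => h2.2 h1
  have hI2 : (prodBernoulli N).real (openConn j b) ≤ (prodBernoulli M).real (openConn j b) +
      (prodBernoulli M).real (openConn s₀ b ∩ (openConn c b)ᶜ ∩ openConn j c) +
      (prodBernoulli M).real (openConn c b ∩ (openConn s₀ b)ᶜ ∩ openConn j s₀) := by
    rw [real_openConn_pair_third M hcs₀ j b]
    have hsub : (openConn j b ∪ openConn j c ∩ openConn s₀ b ∪ openConn j s₀ ∩ openConn c b : Set (BondConfig (Fin n))) ⊆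
        openConn j b ∪ (openConn s₀ b ∩ (openConn c b)ᶜ ∩ openConn j c) ∪ (openConn c b ∩ (openConn s₀ b)ᶜ ∩ openConn j s₀) := by
      rintro ω ((hjb | ⟨hjc, hsb⟩) | ⟨hjs, hcb⟩)
      · exact Or.inl (Or.inl hjb)
      · by_cases hcb : ω ∈ openConn c b
        · exact Or.inl (Or.inl ((hjc : (openGraph ω).Reachable j c).trans (hcb : (openGraph ω).Reachable c b)))
        · exact Or.inl (Or.inr ⟨⟨hsb, hcb⟩, hjc⟩)
      · by_cases hsb : ω ∈ openConn s₀ b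
        · exact Or.inl (Or.inl ((hjs : (openGraph ω).Reachable j s₀).trans (hsb : (openGraph ω).Reachable s₀ b)))
        · exact Or.inr ⟨⟨hcb, hsb⟩, hjs⟩
    calc (prodBernoulli M).real (openConn j b ∪ openConn j c ∩ openConn s₀ b ∪ openConn j s₀ ∩ openConn c b)
        ≤ (prodBernoulli M).real (openConn j b ∪ (openConn s₀ b ∩ (openConn c b)ᶜ ∩ openConn j c) ∪
            (openConn c b ∩ (openConn s₀ b)ᶜ ∩ openConn j s₀)) := measureReal_mono hsub (measure_ne_top _ _)
      _ ≤ (prodBernoulli M).real (openConn j b ∪ (openConn s₀ b ∩ (openConn c b)ᶜ ∩ openConn j c)) +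
            (prodBernoulli M).real (openConn c b ∩ (openConn s₀ b)ᶜ ∩ openConn j s₀) := measureReal_union_le _ _
      _ ≤ _ := by gcongr; exact measureReal_union_le _ _
  have hsplitM := measureReal_inter_add_sdiff (μ := prodBernoulli M) (s := openConn s₀ b ∩ (openConn c b)ᶜ)
    (hmeas (openConn j c)) (measure_ne_top _ _)
  have hB1set : (openConn s₀ b ∩ (openConn c b)ᶜ) \ openConn j c =
      (openConn s₀ b ∩ (openConn c b)ᶜ ∩ (openConn j c)ᶜ : Set (BondConfig (Fin n))) := by
    ext ω; simp only [mem_sdiff, mem_inter_iff, mem_compl_iff]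
  rw [hB1set] at hsplitM
  -- inclusion–exclusion: `M` from `L`
  have hI3 : (prodBernoulli M).real (openConn c b) =
      (prodBernoulli L).real (openConn c b) + (prodBernoulli L).real (openConn d b ∩ (openConn c b)ᶜ) := by
    rw [(real_openConn_pair_eq L hcd b).1]
    have hset : openConn c b ∪ openConn d b = openConn c b ∪ (openConn d b ∩ (openConn c b)ᶜ : Set (BondConfig (Fin n))) := by
      ext ω; simp only [mem_union, mem_inter_iff, mem_compl_iff]; tauto
    rw [hset, measureReal_union _ ((hmeas _).inter (hmeas _))]
    exact Set.disjoint_left.2 fun ω h1 h2 => h2.2 h1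
  have hI4 : (prodBernoulli M).real (openConn s₀ b) ≤ (prodBernoulli L).real (openConn s₀ b) +
      (prodBernoulli L).real (openConn d b ∩ (openConn c b)ᶜ ∩ openConn c s₀) +
      (prodBernoulli L).real (openConn c b ∩ (openConn d b)ᶜ ∩ openConn d s₀) := by
    rw [real_openConn_pair_third L hcd s₀ b]
    have hsub : (openConn s₀ b ∪ openConn s₀ c ∩ openConn d b ∪ openConn s₀ d ∩ openConn c b : Set (BondConfig (Fin n))) ⊆
        openConn s₀ b ∪ (openConn d b ∩ (openConn c b)ᶜ ∩ openConn c s₀) ∪ (openConn c b ∩ (openConn d b)ᶜ ∩ openConn d s₀) := by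
      rintro ω ((hsb | ⟨hsc, hdb⟩) | ⟨hsd, hcb⟩)
      · exact Or.inl (Or.inl hsb)
      · by_cases hcb : ω ∈ openConn c b
        · exact Or.inl (Or.inl ((hsc : (openGraph ω).Reachable s₀ c).trans (hcb : (openGraph ω).Reachable c b)))
        · exact Or.inl (Or.inr ⟨⟨hdb, hcb⟩, (hsc : (openGraph ω).Reachable s₀ c).symm⟩)
      · by_cases hdb : ω ∈ openConn d b
        · exact Or.inl (Or.inl ((hsd : (openGraph ω).Reachable s₀ d).trans (hdb : (openGraph ω).Reachable d b)))
        · exact Or.inr ⟨⟨hcb, hdb⟩, (hsd : (openGraph ω).Reachable s₀ d).symm⟩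
    calc (prodBernoulli L).real (openConn s₀ b ∪ openConn s₀ c ∩ openConn d b ∪ openConn s₀ d ∩ openConn c b)
        ≤ (prodBernoulli L).real (openConn s₀ b ∪ (openConn d b ∩ (openConn c b)ᶜ ∩ openConn c s₀) ∪
            (openConn c b ∩ (openConn d b)ᶜ ∩ openConn d s₀)) := measureReal_mono hsub (measure_ne_top _ _)
      _ ≤ (prodBernoulli L).real (openConn s₀ b ∪ (openConn d b ∩ (openConn c b)ᶜ ∩ openConn c s₀)) +
            (prodBernoulli L).real (openConn c b ∩ (openConn d b)ᶜ ∩ openConn d s₀) := measureReal_union_le _ _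
      _ ≤ _ := by gcongr; exact measureReal_union_le _ _
  have hsplitL := measureReal_inter_add_sdiff (μ := prodBernoulli L) (s := openConn d b ∩ (openConn c b)ᶜ)
    (hmeas (openConn c s₀)) (measure_ne_top _ _)
  have hC3set : (openConn d b ∩ (openConn c b)ᶜ) \ openConn c s₀ =
      (openConn d b ∩ (openConn c b)ᶜ ∩ (openConn c s₀)ᶜ : Set (BondConfig (Fin n))) := by
    ext ω; simp only [mem_sdiff, mem_inter_iff, mem_compl_iff]
  rw [hC3set] at hsplitL
  -- scaled versions for the final linear combination
  have huu : 0 ≤ (u : ℝ) * (1 - (u : ℝ)) := mul_nonneg hu0 hu1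
  have sI1 := congrArg (fun t => (u : ℝ) * t) hI1
  have sI2 := mul_le_mul_of_nonneg_left hI2 hu0
  have sT3 := mul_le_mul_of_nonneg_left hT3 hu0
  have sSM := congrArg (fun t => (u : ℝ) * t) hsplitM
  have sT1 := mul_le_mul_of_nonneg_left hT1 hu1
  have sI3 := congrArg (fun t => (u : ℝ) * (1 - (u : ℝ)) * t) hI3
  have sI4 := mul_le_mul_of_nonneg_left hI4 huu
  have sT2 := mul_le_mul_of_nonneg_left hT2 huu
  have sSL := congrArg (fun t => (u : ℝ) * (1 - (u : ℝ)) * t) hsplitL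
  nlinarith [sI1, sI2, sT3, sSM, sT1, sI3, sI4, sT2, sSL, hu0, hu1]

end UpsetExchange

end

end Summit.CriticalPhenomena.PercolationContinuityZ3.Theorems
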